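import Summits.AtomisticToContinuum.HydrodynamicLimit.Theorems.VitaliAmplitudeTransferAmplitudeTransferPathCalculus
import Summits.AtomisticToContinuum.HydrodynamicLimit.Theorems.VitaliAmplitudeTransferAmplitudeTransferMeanLipschitz
import Summits.AtomisticToContinuum.HydrodynamicLimit.Theorems.VitaliAmplitudeTransferAmplitudeTransferTransfer
import Summits.AtomisticToContinuum.HydrodynamicLimit.Theorems.VitaliAmplitudeTransferAmplitudeTransferFields

/-!
# Amplitude transfer — equi-Lipschitz local Gibbs means along a `C¹` path (step (4), assembled)

For a path of local Gibbs profiles `s ↦ (a_s, u_s, θ_s)` whose space–time lifts are `C¹` on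
`[0,1] × ℝ³` and which stays within two-sided bounds `B` (the frame of `FieldVarianceBound` in
route `VitaliAmplitudeTransfer`), there are a growth constant `K` and one-body scores `π_s`
(`s ∈ (0,1)`; continuous, `|π_s| ≤ K (1 + |v|²)`), depending only on the path, such that for every
particle number, flow, observable `w` of quadratic velocity growth and time `t`, CLT-size variance
bounds `(N+1) Var_{ψ_s}(∫ w dμ_{Φ_t z}) ≤ C_t` on `[0,1]` and `(N+1) Var_{ψ_s}(∫ π_s dμ_{Φ_0 z}) ≤ C₀`
on `(0,1)` make the means `s ↦ E_{ψ_s}[∫ w dμ_{Φ_t z}]` Lipschitz on `[0,1]` with the `N`-independent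
constant `√C_t √C₀` (item `AmplitudeTransfer`, step (4): `d/ds E = (N+1) Cov`, Cauchy–Schwarz,
mean value theorem).

Then `tendsto_scalar_at_one` runs steps (3)–(5) of the transfer for ONE scalar observable along the
path, given the instantiated frames of `UniformAmplitudeAnalyticity`, `NearEquilibriumLimit` and
`FieldVarianceBound` (hypotheses `hA`, `hB`, `hV`, verbatim at a bound `B` and reduced diameter `σ`):
Vitali on sub-paths, the equi-Lipschitz endpoint, and Chebyshev at `δ = 1`.
-/

noncomputable section

open MeasureTheory ProbabilityTheory Real Filter Set Topology
open scoped InnerProductSpace ENNReal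

namespace Summit.AtomisticToContinuum.HydrodynamicLimit.Theorems.AmplitudeTransfer

open Literature.MathematicalPhysics.KineticTheory Literature.Analysis.FluidPDE
open Literature.Analysis.FunctionSpaces

/-- **Equi-Lipschitz local Gibbs means along a `C¹` path of profiles.** See the module
docstring; the scores are `π_s(x,v) = a'/a - (3/2) θ'/θ + ⟪v - u, u'⟫/θ + |v - u|² θ'/(2θ²)` with
`a' = ∂_s a_s(x)` etc., and `K = 10 K₁ B⁴` for a uniform bound `K₁` of the path-derivatives. -/
theorem equiLipschitz_mean {σ : ℝ} {a θ : ℝ → T3 → ℝ} {u : ℝ → T3 → V3} {B : ℝ} (hB : 1 ≤ B)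
    (ha : ContDiffOn ℝ 1 (Torus.stLift a) (Icc (0 : ℝ) 1 ×ˢ univ))
    (hθ : ContDiffOn ℝ 1 (Torus.stLift θ) (Icc (0 : ℝ) 1 ×ˢ univ))
    (hu : ContDiffOn ℝ 1 (Torus.stLift u) (Icc (0 : ℝ) 1 ×ˢ univ))
    (hbd : ∀ s ∈ Icc (0 : ℝ) 1, ∀ x,
      B⁻¹ ≤ a s x ∧ a s x ≤ B ∧ B⁻¹ ≤ θ s x ∧ θ s x ≤ B ∧ ‖u s x‖ ≤ B) :
    ∃ K : ℝ, 0 ≤ K ∧ ∃ sc : ℝ → T3 × V3 → ℝ,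
      (∀ s ∈ Ioo (0 : ℝ) 1, Continuous (sc s)) ∧
      (∀ s ∈ Ioo (0 : ℝ) 1, ∀ y, |sc s y| ≤ K * (1 + ‖y.2‖ ^ 2)) ∧
      ∀ (N : ℕ) (Φ : HardSphereFlow (Torus.geometry (Fin 3)) (hsDiameter σ N) (N + 1)),
        (∀ s ∈ Icc (0 : ℝ) 1, IsProbabilityMeasure (localGibbsLaw σ (a s) (u s) (θ s) N Φ)) →
        ∀ (w : T3 × V3 → ℝ), Continuous w → ∀ Cw : ℝ, (∀ y, |w y| ≤ Cw * (1 + ‖y.2‖ ^ 2)) →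
        ∀ (t Ct C0 : ℝ), 0 ≤ Ct → 0 ≤ C0 →
        (∀ s ∈ Icc (0 : ℝ) 1, ((N : ℝ≥0∞) + 1) *
          evariance (fun z => ∫ y, w y ∂(empiricalMeasure (Φ.flow t z)))
            (localGibbsLaw σ (a s) (u s) (θ s) N Φ) ≤ ENNReal.ofReal Ct) →
        (∀ s ∈ Ioo (0 : ℝ) 1, ((N : ℝ≥0∞) + 1) *
          evariance (fun z => ∫ y, sc s y ∂(empiricalMeasure (Φ.flow 0 z)))
            (localGibbsLaw σ (a s) (u s) (θ s) N Φ) ≤ ENNReal.ofReal C0) →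
        ∀ s ∈ Icc (0 : ℝ) 1, ∀ s' ∈ Icc (0 : ℝ) 1,
          |(∫ z, (∫ y, w y ∂(empiricalMeasure (Φ.flow t z))) ∂(localGibbsLaw σ (a s) (u s) (θ s) N Φ)) -
            ∫ z, (∫ y, w y ∂(empiricalMeasure (Φ.flow t z))) ∂(localGibbsLaw σ (a s') (u s') (θ s') N Φ)|
            ≤ Real.sqrt Ct * Real.sqrt C0 * |s - s'| := by
  have hB0 : 0 < B := by linarith
  have hsub : Ioo (0 : ℝ) 1 ⊆ Icc 0 1 := Ioo_subset_Icc_self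
  -- pointwise regularity of the three profiles
  obtain ⟨hac, hacs, had, hadc, Ka, hKa0, hKa⟩ := path_regular_of_contDiffOn ha
  obtain ⟨hθc, hθcs, hθd, hθdc, Kθ, hKθ0, hKθ⟩ := path_regular_of_contDiffOn hθ
  obtain ⟨huc, hucs, hud, hudc, Ku, hKu0, hKu⟩ := path_regular_of_contDiffOn hu
  set K₁ : ℝ := max Ka (max Kθ Ku) with hK₁
  have hK₁0 : 0 ≤ K₁ := hKa0.trans (le_max_left _ _)
  have hKa1 : Ka ≤ K₁ := le_max_left _ _
  have hKθ1 : Kθ ≤ K₁ := (le_max_left _ _).trans (le_max_right _ _)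
  have hKu1 : Ku ≤ K₁ := (le_max_right _ _).trans (le_max_right _ _)
  -- the path-derivatives
  set a' : ℝ → T3 → ℝ := fun s x => deriv (fun r => a r x) s with ha'
  set θ' : ℝ → T3 → ℝ := fun s x => deriv (fun r => θ r x) s with hθ'
  set u' : ℝ → T3 → V3 := fun s x => deriv (fun r => u r x) s with hu'
  have hbd' : ∀ s ∈ Ioo (0 : ℝ) 1, ∀ x, |a' s x| ≤ K₁ ∧ |θ' s x| ≤ K₁ ∧ ‖u' s x‖ ≤ K₁ :=
    fun s hs x => ⟨(Real.norm_eq_abs _ ▸ hKa s hs x).trans hKa1,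
      (Real.norm_eq_abs _ ▸ hKθ s hs x).trans hKθ1, (hKu s hs x).trans hKu1⟩
  have hpos : ∀ s ∈ Ioo (0 : ℝ) 1, ∀ x, 0 < a s x ∧ 0 < θ s x := fun s hs x =>
    ⟨lt_of_lt_of_le (inv_pos.2 hB0) (hbd s (hsub hs) x).1,
      lt_of_lt_of_le (inv_pos.2 hB0) (hbd s (hsub hs) x).2.2.1⟩
  -- the scores
  set K : ℝ := 10 * K₁ * B ^ 4 with hK
  refine ⟨K, by positivity, fun s y => (a' s y.1 / a s y.1 - 3 / 2 * (θ' s y.1 / θ s y.1) +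
      ⟪y.2 - u s y.1, u' s y.1⟫_ℝ / θ s y.1 + ‖y.2 - u s y.1‖ ^ 2 * θ' s y.1 / (2 * θ s y.1 ^ 2)),
    fun s hs => ?_, fun s hs y => ?_, ?_⟩
  · exact continuous_score (hac s (hsub hs)) (hadc s hs) (hθc s (hsub hs)) (hθdc s hs)
      (huc s (hsub hs)) (hudc s hs) (fun x => (hpos s hs x).1.ne') (fun x => (hpos s hs x).2.ne')
  · exact abs_score_le hB hK₁0 (hbd s (hsub hs) y.1).1 (hbd s (hsub hs) y.1).2.2.1
      (hbd s (hsub hs) y.1).2.2.2.2 (hbd' s hs y.1).1 (hbd' s hs y.1).2.1 (hbd' s hs y.1).2.2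
  intro N Φ hprob w hw Cw hwb t Ct C0 hCt hC0 hVt hV0
  have hcont : ∀ s ∈ Icc (0 : ℝ) 1, Continuous (a s) ∧ Continuous (θ s) ∧ Continuous (u s) :=
    fun s hs => ⟨hac s hs, hθc s hs, huc s hs⟩
  have hconts : ∀ x, ContinuousOn (fun s => a s x) (Icc 0 1) ∧ ContinuousOn (fun s => θ s x) (Icc 0 1) ∧
      ContinuousOn (fun s => u s x) (Icc 0 1) := fun x => ⟨hacs x, hθcs x, hucs x⟩
  -- the derivative of the weight along the path is the total score times the weight
  have hπd : ∀ s ∈ Ioo (0 : ℝ) 1, ∀ z : Config (N + 1) (Fin 3) T3,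
      HasDerivAt (fun r => ((hardSphereDomain (Torus.geometry (Fin 3)) (N + 1) (hsDiameter σ N)).indicator
        (tensorPow (N + 1) (localGibbsProfile (a r) (u r) (θ r)))) z)
        ((∑ i, (a' s (z i).1 / a s (z i).1 - 3 / 2 * (θ' s (z i).1 / θ s (z i).1) +
          ⟪(z i).2 - u s (z i).1, u' s (z i).1⟫_ℝ / θ s (z i).1 +
          ‖(z i).2 - u s (z i).1‖ ^ 2 * θ' s (z i).1 / (2 * θ s (z i).1 ^ 2))) *
          ((hardSphereDomain (Torus.geometry (Fin 3)) (N + 1) (hsDiameter σ N)).indicator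
            (tensorPow (N + 1) (localGibbsProfile (a s) (u s) (θ s)))) z) s :=
    fun s hs z => hasDerivAt_weight (σ := σ) (N := N) (a' := a' s) (θ' := θ' s) (u' := u' s)
      (Ioo_mem_nhds hs.1 hs.2) hpos (fun x => ⟨had s hs x, hθd s hs x, hud s hs x⟩) z
  exact abs_mean_sub_mean_le Φ hB hcont hconts hbd (by positivity)
    (fun s hs => continuous_score (hac s (hsub hs)) (hadc s hs) (hθc s (hsub hs)) (hθdc s hs)
      (huc s (hsub hs)) (hudc s hs) (fun x => (hpos s hs x).1.ne') (fun x => (hpos s hs x).2.ne'))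
    (fun s hs y => abs_score_le hB hK₁0 (hbd s (hsub hs) y.1).1 (hbd s (hsub hs) y.1).2.2.1
      (hbd s (hsub hs) y.1).2.2.2.2 (hbd' s hs y.1).1 (hbd' s hs y.1).2.1 (hbd' s hs y.1).2.2)
    hπd hprob hw hwb t hCt hC0 hVt hV0

/-- **Steps (3)–(5) of the transfer for one scalar observable.** See the module docstring. -/
theorem tendsto_scalar_at_one {σ B : ℝ} (hBs : 1 ≤ B) {a θp : ℝ → T3 → ℝ} {up : ℝ → T3 → V3}
    {T' t : ℝ} (htT' : t ∈ Ico 0 T') {ρE θE : ℝ → ℝ → T3 → ℝ} {uE : ℝ → ℝ → T3 → V3}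
    {Φ : (N : ℕ) → HardSphereFlow (Torus.geometry (Fin 3)) (hsDiameter σ N) (N + 1)}
    (hA :
      ∀ (a θp : ℝ → T3 → ℝ) (up : ℝ → T3 → V3), AnalyticOnNhd ℝ (Torus.stLift a) (Set.Icc 0 1 ×ˢ
      Set.univ) → AnalyticOnNhd ℝ (Torus.stLift θp) (Set.Icc 0 1 ×ˢ Set.univ) → AnalyticOnNhd ℝ
      (Torus.stLift up) (Set.Icc 0 1 ×ˢ Set.univ) → (∀ δ ∈ Set.Icc (0:ℝ) 1, ∀ x, B⁻¹ ≤ a δ x ∧ a δ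
      x ≤ B ∧ B⁻¹ ≤ θp δ x ∧ θp δ x ≤ B ∧ ‖up δ x‖ ≤ B) → ∀ (T' : ℝ) (ρE θE : ℝ → ℝ → T3 → ℝ) (uE :
      ℝ → ℝ → T3 → V3), (∀ δ ∈ Set.Icc (0:ℝ) 1, IsHardSphereEulerSolution σ T' (ρE δ) (uE δ) (θE
      δ)) → ∀ Φ : (N : ℕ) → HardSphereFlow (Torus.geometry (Fin 3)) (hsDiameter σ N) (N + 1), (∀ δ
      ∈ Set.Icc (0:ℝ) 1, (∀ N, IsProbabilityMeasure (localGibbsLaw σ (a δ) (up δ) (θp δ) N (Φ N)))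
      ∧ TendstoHydroFieldsAt (fun N => localGibbsLaw σ (a δ) (up δ) (θp δ) N (Φ N)) Φ (ρE δ) (uE δ)
      (θE δ) 0) → ∀ t ∈ Set.Ico 0 T', ∀ w : T3 × V3 → ℝ, Continuous w → (∃ Cw : ℝ, ∀ y, |w y| ≤ Cw
      * (1 + ‖y.2‖ ^ 2)) → ∃ r : ℝ, 0 < r ∧ ∃ M : ℝ, ∀ N : ℕ, ∃ g : ℂ → ℂ, DifferentiableOn ℂ g
      (Metric.thickening r (Complex.ofReal '' Set.Icc (0:ℝ) 1)) ∧ (∀ ζ ∈ Metric.thickening r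
      (Complex.ofReal '' Set.Icc (0:ℝ) 1), ‖g ζ‖ ≤ M) ∧ ∀ δ ∈ Set.Icc (0:ℝ) 1, g (δ : ℂ) = ((∫ z,
      (∫ y, w y ∂(empiricalMeasure ((Φ N).flow t z))) ∂(localGibbsLaw σ (a δ) (up δ) (θp δ) N (Φ
      N)) : ℝ) : ℂ))
    (hB :
      ∀ (a θp : ℝ → T3 → ℝ) (up : ℝ → T3 → V3), AnalyticOnNhd ℝ (Torus.stLift a) (Set.Icc 0 1 ×ˢ
      Set.univ) → AnalyticOnNhd ℝ (Torus.stLift θp) (Set.Icc 0 1 ×ˢ Set.univ) → AnalyticOnNhd ℝ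
      (Torus.stLift up) (Set.Icc 0 1 ×ˢ Set.univ) → (∀ δ ∈ Set.Icc (0:ℝ) 1, ∀ x, B⁻¹ ≤ a δ x ∧ a δ
      x ≤ B ∧ B⁻¹ ≤ θp δ x ∧ θp δ x ≤ B ∧ ‖up δ x‖ ≤ B) → (∀ x y, a 0 x = a 0 y ∧ θp 0 x = θp 0 y ∧
      up 0 x = up 0 y) → ∀ (T' : ℝ) (ρE θE : ℝ → ℝ → T3 → ℝ) (uE : ℝ → ℝ → T3 → V3), (∀ δ ∈ Set.Icc
      (0:ℝ) 1, IsHardSphereEulerSolution σ T' (ρE δ) (uE δ) (θE δ)) → ∀ Φ : (N : ℕ) →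
      HardSphereFlow (Torus.geometry (Fin 3)) (hsDiameter σ N) (N + 1), (∀ δ ∈ Set.Icc (0:ℝ) 1, (∀
      N, IsProbabilityMeasure (localGibbsLaw σ (a δ) (up δ) (θp δ) N (Φ N))) ∧ TendstoHydroFieldsAt
      (fun N => localGibbsLaw σ (a δ) (up δ) (θp δ) N (Φ N)) Φ (ρE δ) (uE δ) (θE δ) 0) → ∃ δ₁ : ℝ,
      0 < δ₁ ∧ ∀ δ ∈ Set.Ico (0:ℝ) δ₁, ∀ t ∈ Set.Ico 0 T', TendstoHydroFieldsAt (fun N =>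
      localGibbsLaw σ (a δ) (up δ) (θp δ) N (Φ N)) Φ (ρE δ) (uE δ) (θE δ) t)
    (hV :
      ∀ (a θp : ℝ → T3 → ℝ) (up : ℝ → T3 → V3), ContDiffOn ℝ 1 (Torus.stLift a) (Set.Icc 0 1 ×ˢ
      Set.univ) → ContDiffOn ℝ 1 (Torus.stLift θp) (Set.Icc 0 1 ×ˢ Set.univ) → ContDiffOn ℝ 1
      (Torus.stLift up) (Set.Icc 0 1 ×ˢ Set.univ) → (∀ δ ∈ Set.Icc (0:ℝ) 1, ∀ x, B⁻¹ ≤ a δ x ∧ a δ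
      x ≤ B ∧ B⁻¹ ≤ θp δ x ∧ θp δ x ≤ B ∧ ‖up δ x‖ ≤ B) → ∀ (T' : ℝ) (ρE θE : ℝ → ℝ → T3 → ℝ) (uE :
      ℝ → ℝ → T3 → V3), (∀ δ ∈ Set.Icc (0:ℝ) 1, IsHardSphereEulerSolution σ T' (ρE δ) (uE δ) (θE
      δ)) → ∀ Φ : (N : ℕ) → HardSphereFlow (Torus.geometry (Fin 3)) (hsDiameter σ N) (N + 1), (∀ δ
      ∈ Set.Icc (0:ℝ) 1, (∀ N, IsProbabilityMeasure (localGibbsLaw σ (a δ) (up δ) (θp δ) N (Φ N)))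
      ∧ TendstoHydroFieldsAt (fun N => localGibbsLaw σ (a δ) (up δ) (θp δ) N (Φ N)) Φ (ρE δ) (uE δ)
      (θE δ) 0) → ∀ t ∈ Set.Ico 0 T', ContDiffOn ℝ 1 (fun p : ℝ × ℝ × EuclideanSpace ℝ (Fin 3) =>
      ρE p.1 p.2.1 (Torus.proj p.2.2)) (Set.Icc 0 1 ×ˢ Set.Icc 0 t ×ˢ Set.univ) → ContDiffOn ℝ 1
      (fun p : ℝ × ℝ × EuclideanSpace ℝ (Fin 3) => θE p.1 p.2.1 (Torus.proj p.2.2)) (Set.Icc 0 1 ×ˢ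
      Set.Icc 0 t ×ˢ Set.univ) → ContDiffOn ℝ 1 (fun p : ℝ × ℝ × EuclideanSpace ℝ (Fin 3) => uE p.1
      p.2.1 (Torus.proj p.2.2)) (Set.Icc 0 1 ×ˢ Set.Icc 0 t ×ˢ Set.univ) → ∀ Cw : ℝ, ∃ C : ℝ, ∀ w :
      T3 × V3 → ℝ, Continuous w → (∀ y, |w y| ≤ Cw * (1 + ‖y.2‖ ^ 2)) → ∀ N : ℕ, ∀ δ ∈ Set.Icc
      (0:ℝ) 1, ((N : ENNReal) + 1) * evariance (fun z => ∫ y, w y ∂(empiricalMeasure ((Φ N).flow t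
      z))) (localGibbsLaw σ (a δ) (up δ) (θp δ) N (Φ N)) ≤ ENNReal.ofReal C)
    (hP1 : ∀ δ ∈ Icc (0 : ℝ) 1, ∀ x,
      B⁻¹ ≤ a δ x ∧ a δ x ≤ B ∧ B⁻¹ ≤ θp δ x ∧ θp δ x ≤ B ∧ ‖up δ x‖ ≤ B)
    (hP3a : ContDiffOn ℝ 1 (Torus.stLift a) (Icc 0 1 ×ˢ univ))
    (hP3θ : ContDiffOn ℝ 1 (Torus.stLift θp) (Icc 0 1 ×ˢ univ))
    (hP3u : ContDiffOn ℝ 1 (Torus.stLift up) (Icc 0 1 ×ˢ univ))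
    (hEsol : ∀ δ ∈ Icc (0 : ℝ) 1, IsHardSphereEulerSolution σ T' (ρE δ) (uE δ) (θE δ))
    (hP5 : ∀ δ ∈ Icc (0 : ℝ) 1,
      (∀ N, IsProbabilityMeasure (localGibbsLaw σ (a δ) (up δ) (θp δ) N (Φ N))) ∧
      TendstoHydroFieldsAt (fun N => localGibbsLaw σ (a δ) (up δ) (θp δ) N (Φ N)) Φ
        (ρE δ) (uE δ) (θE δ) 0)
    (hEC1ρ : ContDiffOn ℝ 1 (fun p : ℝ × ℝ × EuclideanSpace ℝ (Fin 3) => ρE p.1 p.2.1 (Torus.proj p.2.2))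
      (Icc 0 1 ×ˢ Icc 0 t ×ˢ univ))
    (hEC1θ : ContDiffOn ℝ 1 (fun p : ℝ × ℝ × EuclideanSpace ℝ (Fin 3) => θE p.1 p.2.1 (Torus.proj p.2.2))
      (Icc 0 1 ×ˢ Icc 0 t ×ˢ univ))
    (hEC1u : ContDiffOn ℝ 1 (fun p : ℝ × ℝ × EuclideanSpace ℝ (Fin 3) => uE p.1 p.2.1 (Torus.proj p.2.2))
      (Icc 0 1 ×ˢ Icc 0 t ×ˢ univ))
    (hsub : ∀ δ₂ ∈ Ioo (0 : ℝ) 1,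
      AnalyticOnNhd ℝ (Torus.stLift fun δ => a (δ₂ * δ)) (Icc 0 1 ×ˢ univ) ∧
      AnalyticOnNhd ℝ (Torus.stLift fun δ => θp (δ₂ * δ)) (Icc 0 1 ×ˢ univ) ∧
      AnalyticOnNhd ℝ (Torus.stLift fun δ => up (δ₂ * δ)) (Icc 0 1 ×ˢ univ) ∧
      (∀ δ ∈ Icc (0 : ℝ) 1, ∀ x, B⁻¹ ≤ a (δ₂ * δ) x ∧ a (δ₂ * δ) x ≤ B ∧
        B⁻¹ ≤ θp (δ₂ * δ) x ∧ θp (δ₂ * δ) x ≤ B ∧ ‖up (δ₂ * δ) x‖ ≤ B) ∧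
      (∀ x y, a (δ₂ * 0) x = a (δ₂ * 0) y ∧ θp (δ₂ * 0) x = θp (δ₂ * 0) y ∧
        up (δ₂ * 0) x = up (δ₂ * 0) y) ∧
      (∀ δ ∈ Icc (0 : ℝ) 1, IsHardSphereEulerSolution σ T' (ρE (δ₂ * δ)) (uE (δ₂ * δ)) (θE (δ₂ * δ))) ∧
      (∀ δ ∈ Icc (0 : ℝ) 1,
        (∀ N, IsProbabilityMeasure (localGibbsLaw σ (a (δ₂ * δ)) (up (δ₂ * δ)) (θp (δ₂ * δ)) N (Φ N))) ∧
        TendstoHydroFieldsAt (fun N => localGibbsLaw σ (a (δ₂ * δ)) (up (δ₂ * δ)) (θp (δ₂ * δ)) N (Φ N)) Φ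
          (ρE (δ₂ * δ)) (uE (δ₂ * δ)) (θE (δ₂ * δ)) 0))
    {w : T3 × V3 → ℝ} (hw : Continuous w) {Cw : ℝ} (hwb : ∀ y, |w y| ≤ Cw * (1 + ‖y.2‖ ^ 2))
    {e : ℝ → ℝ} (he : AnalyticOnNhd ℝ e (Ico 0 1)) (he1 : ContinuousWithinAt e (Icc 0 1) 1)
    (hprobE : ∀ δ ∈ Icc (0 : ℝ) 1, TendstoHydroFieldsAt
        (fun N => localGibbsLaw σ (a δ) (up δ) (θp δ) N (Φ N)) Φ (ρE δ) (uE δ) (θE δ) t →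
      ∀ η > (0 : ℝ), Tendsto (fun N => localGibbsLaw σ (a δ) (up δ) (θp δ) N (Φ N)
        {z | η < |(∫ y, w y ∂(empiricalMeasure ((Φ N).flow t z))) - e δ|}) atTop (𝓝 0))
    {η : ℝ} (hη : 0 < η) :
    Tendsto (fun N => localGibbsLaw σ (a 1) (up 1) (θp 1) N (Φ N)
      {z | η < |(∫ y, w y ∂(empiricalMeasure ((Φ N).flow t z))) - e 1|}) atTop (𝓝 0) := by
  have h1I : (1 : ℝ) ∈ Icc (0 : ℝ) 1 := ⟨zero_le_one, le_rfl⟩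
  have h0T' : (0 : ℝ) ∈ Ico 0 T' := ⟨le_rfl, lt_of_le_of_lt htT'.1 htT'.2⟩
  /- step (4), part 1: equi-Lipschitz constant and scores; `FieldVarianceBound` at time `0` -/
  obtain ⟨K, hK0, sc, hscc, hscb, hLip⟩ := equiLipschitz_mean (σ := σ) hBs hP3a hP3θ hP3u hP1
  have hsub0 : Icc (0 : ℝ) 1 ×ˢ Icc (0 : ℝ) 0 ×ˢ (univ : Set (EuclideanSpace ℝ (Fin 3))) ⊆
      Icc 0 1 ×ˢ Icc 0 t ×ˢ univ :=
    prod_mono le_rfl (prod_mono (Icc_subset_Icc le_rfl htT'.1) le_rfl)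
  obtain ⟨C0, hC0⟩ := hV a θp up hP3a hP3θ hP3u hP1 T' ρE θE uE hEsol Φ hP5 0 h0T'
    (hEC1ρ.mono hsub0) (hEC1θ.mono hsub0) (hEC1u.mono hsub0) K
  have hC0' : ∀ (N : ℕ), ∀ s ∈ Ioo (0 : ℝ) 1, ((N : ℝ≥0∞) + 1) *
      evariance (fun z => ∫ y, sc s y ∂(empiricalMeasure ((Φ N).flow 0 z)))
        (localGibbsLaw σ (a s) (up s) (θp s) N (Φ N)) ≤ ENNReal.ofReal (max C0 0) :=
    fun N s hs => (hC0 (sc s) (hscc s hs) (hscb s hs) N s (Ioo_subset_Icc_self hs)).trans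
      (ENNReal.ofReal_le_ofReal (le_max_left _ _))
  -- `FieldVarianceBound` at time `t` for `w`
  obtain ⟨Ct, hCt⟩ := hV a θp up hP3a hP3θ hP3u hP1 T' ρE θE uE hEsol Φ hP5 t htT'
    hEC1ρ hEC1θ hEC1u Cw
  have hCt' : ∀ (N : ℕ), ∀ s ∈ Icc (0 : ℝ) 1, ((N : ℝ≥0∞) + 1) *
      evariance (fun z => ∫ y, w y ∂(empiricalMeasure ((Φ N).flow t z)))
        (localGibbsLaw σ (a s) (up s) (θp s) N (Φ N)) ≤ ENNReal.ofReal (max Ct 0) :=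
    fun N s hs => (hCt w hw hwb N s hs).trans (ENNReal.ofReal_le_ofReal (le_max_left _ _))
  -- the means along the path
  set m : ℕ → ℝ → ℝ := fun N δ => ∫ z, (∫ y, w y ∂(empiricalMeasure ((Φ N).flow t z)))
    ∂(localGibbsLaw σ (a δ) (up δ) (θp δ) N (Φ N)) with hmdef
  have hXm : ∀ N, Measurable fun z : Config (N + 1) (Fin 3) T3 =>
      ∫ y, w y ∂(empiricalMeasure ((Φ N).flow t z)) :=
    fun N => measurable_integral_empiricalMeasure_flow (Φ N) hw t
  -- step (4): equi-Lipschitz means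
  have hlip : ∀ N, ∀ δ ∈ Icc (0 : ℝ) 1,
      |m N 1 - m N δ| ≤ Real.sqrt (max Ct 0) * Real.sqrt (max C0 0) * (1 - δ) := by
    intro N δ hδ
    have h := hLip N (Φ N) (fun s hs => (hP5 s hs).1 N) w hw Cw hwb t (max Ct 0) (max C0 0)
      (le_max_right _ _) (le_max_right _ _) (hCt' N) (hC0' N) 1 h1I δ hδ
    rwa [abs_of_nonneg (by linarith [hδ.2] : (0 : ℝ) ≤ 1 - δ)] at h
  -- step (3): analyticity with uniform bounds on sub-paths (`UniformAmplitudeAnalyticity`)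
  have hAsub : ∀ δ₂ ∈ Ioo (0 : ℝ) 1, ∃ r : ℝ, 0 < r ∧ ∃ M : ℝ, ∀ N, ∃ g : ℂ → ℂ,
      DifferentiableOn ℂ g (Metric.thickening r (Complex.ofReal '' Icc (0 : ℝ) 1)) ∧
      (∀ ζ ∈ Metric.thickening r (Complex.ofReal '' Icc (0 : ℝ) 1), ‖g ζ‖ ≤ M) ∧
      ∀ δ ∈ Icc (0 : ℝ) 1, g (δ : ℂ) = ((m N (δ₂ * δ) : ℝ) : ℂ) := by
    intro δ₂ hδ₂
    obtain ⟨han_a, han_θ, han_u, hbd2, -, hsol2, hlln2⟩ := hsub δ₂ hδ₂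
    obtain ⟨r, hr, M, hg⟩ := hA (fun δ => a (δ₂ * δ)) (fun δ => θp (δ₂ * δ))
      (fun δ => up (δ₂ * δ)) han_a han_θ han_u hbd2 T' (fun δ => ρE (δ₂ * δ))
      (fun δ => θE (δ₂ * δ)) (fun δ => uE (δ₂ * δ)) hsol2 Φ hlln2 t htT' w hw ⟨Cw, hwb⟩
    exact ⟨r, hr, M, hg⟩
  -- step (3): convergence of the means on sub-paths (`NearEquilibriumLimit` + variance)
  have hBsub : ∀ δ₂ ∈ Ioo (0 : ℝ) 1, ∃ δ₁ : ℝ, 0 < δ₁ ∧ ∀ δ ∈ Ioo (0 : ℝ) δ₁, δ ≤ 1 →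
      Tendsto (fun N => m N (δ₂ * δ)) atTop (𝓝 (e (δ₂ * δ))) := by
    intro δ₂ hδ₂
    obtain ⟨han_a, han_θ, han_u, hbd2, hconst2, hsol2, hlln2⟩ := hsub δ₂ hδ₂
    obtain ⟨δ₁, hδ₁, hconv⟩ := hB (fun δ => a (δ₂ * δ)) (fun δ => θp (δ₂ * δ))
      (fun δ => up (δ₂ * δ)) han_a han_θ han_u hbd2 hconst2 T' (fun δ => ρE (δ₂ * δ))
      (fun δ => θE (δ₂ * δ)) (fun δ => uE (δ₂ * δ)) hsol2 Φ hlln2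
    refine ⟨δ₁, hδ₁, fun δ hδ hδ1 => ?_⟩
    have hmem : δ₂ * δ ∈ Icc (0 : ℝ) 1 :=
      ⟨mul_nonneg hδ₂.1.le hδ.1.le, by nlinarith [hδ₂.2, hδ₂.1, hδ.1]⟩
    have hTH := hconv δ ⟨hδ.1.le, hδ.2⟩ t htT'
    haveI : ∀ N, IsProbabilityMeasure (localGibbsLaw σ (a (δ₂ * δ)) (up (δ₂ * δ)) (θp (δ₂ * δ))
      N (Φ N)) := (hP5 _ hmem).1
    exact tendsto_mean_of_prob_of_evariance (P := fun N => localGibbsLaw σ (a (δ₂ * δ))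
      (up (δ₂ * δ)) (θp (δ₂ * δ)) N (Φ N)) (fun N => (hXm N).aestronglyMeasurable)
      (fun N => hCt' N _ hmem) (hprobE _ hmem hTH)
  -- steps (3)–(4): convergence at the endpoint
  have hlim : Tendsto (fun N => m N 1) atTop (𝓝 (e 1)) := tendsto_one_of_subpaths hAsub hBsub he he1 hlip
  -- step (5): Chebyshev at `δ = 1`
  haveI : ∀ N, IsProbabilityMeasure (localGibbsLaw σ (a 1) (up 1) (θp 1) N (Φ N)) := (hP5 1 h1I).1
  exact tendsto_measure_lt_abs_sub_of_evariance_le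
    (P := fun N => localGibbsLaw σ (a 1) (up 1) (θp 1) N (Φ N))
    (fun N => (hXm N).aestronglyMeasurable) (fun N => hCt' N 1 h1I) hlim hη

end Summit.AtomisticToContinuum.HydrodynamicLimit.Theorems.AmplitudeTransfer

end
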